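import Mathlib
import HarnessLib

/-!
# DusartShortIntervalPrimes

Topic `Literature/NumberTheory/LFunctions`. Named literature fact(s) relocated by the gate from `Summits/RiemannHypothesis/RiemannHypothesis/Theorems/HandoffEdgeDusart.lean`
(accept-time relocation of `[cite]`d propositions written inline in a Summits proposal; human ruling 2026-08-15).
Sources: Dusart2010.

* `Literature.NumberTheory.LFunctions.Dusart2010_prop68`
-/

namespace Literature.NumberTheory.LFunctions

open Complex Filter Set MeasureTheory Literature.NumberTheory.LFunctions
open scoped Real Topology ComplexConjugate ContDiff

/-- NAMED FACT — **Dusart 2010, Proposition 6.8** (P. Dusart, *Estimates of some functions over primes without R.H.*,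
arXiv:1002.0442 (2010), §6.1.3 Prop. 6.8, p. 9, as printed: «For all `x ≥ 396 738`, there exists a prime `p` such that
`x < p ≤ x(1 + 1/(25 ln² x))`.»; published form: P. Dusart, *Explicit estimates of some functions over primes*,
Ramanujan J. 45 (2018) 227–251). A PROVED theorem in print (explicit short intervals containing primes); not proved in
the tree. Users take `(h : Dusart2010_prop68)`.
[cite: Dusart2010, Prop. 6.8 (§6.1.3, p. 9)] [file NumberTheory/LFunctions/DusartShortIntervalPrimes] -/
def Dusart2010_prop68 : Prop :=
  ∀ x : ℝ, 396738 ≤ x → ∃ p : ℕ, p.Prime ∧ x < p ∧ (p : ℝ) ≤ x * (1 + 1 / (25 * Real.log x ^ 2))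

end Literature.NumberTheory.LFunctions
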